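import Mathlib
import Summits.Ventures.PercRepro2.TypedPocketClasses
import Summits.Ventures.PercRepro2.CutRootsTheorem

/-!
# The cut-roots class is mild (blind cell PercRepro2, p3 g4, 2026-08-25; a support for S4's
hypothesis list — `proofs/subclaims/S2-SEPARATED.md` §4g)

At `z ≡ false` the class `HasCutRoots` (`o, b, a₃` behind an unmarked cut vertex `c`, both roots
on the other side) is the mark pocket, which is uncrossed (`UncrossedInst.of_pocket`), and an
uncrossed instance is mild (a badly crossed configuration is in particular crossed).  Hence on the
domain of record the conjunct `¬ HasCutRoots` is IMPLIED by `¬ MildInst`: the field `no_cutRoots`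
of `ResidualCoreNHatCTBR` is redundant once `not_mild` is present.  Own work; standard axioms.
-/

namespace Summit.Ventures.PercRepro2

open UnionCluster

namespace CovForm

namespace RootBridge

section MildCutRoots

variable {V : Type*} {E : Type*} [Fintype E] [DecidableEq E]
variable (ends : E → Sym2 V) (o a₁ a₂ a₃ b : V)

omit [Fintype E] in
/-- **Uncrossed implies mild**: a badly crossed configuration is crossed. -/
theorem MildInst.of_uncrossed {F : Finset E} {z : Config E}
    (h : UncrossedInst ends o a₁ a₂ a₃ b F z) : MildInst ends o a₁ a₂ a₃ b F z :=
  ⟨fun x hx hbad => h.not_crossed x hx hbad.crossed⟩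

omit [Fintype E] in
/-- **The cut-roots class is uncrossed**: `CutRoots` is the mark pocket of
`UncrossedInst.of_pocket` (every mark of `{o, b, a₃}` behind the unmarked `c`). -/
theorem UncrossedInst.of_cutRoots {c : V} {VL VH : Set V} {F : Finset E} {z : Config E}
    (h : CutRoots ends o a₁ a₂ a₃ b c VL VH F z) : UncrossedInst ends o a₁ a₂ a₃ b F z :=
  UncrossedInst.of_pocket ends o a₁ a₂ a₃ b c h.split h.cap h.cL h.cH h.oL h.bL h.a3L h.a1H h.a2H
    h.oc h.bc h.a3c

omit [Fintype E] in
/-- **The cut-roots class at `z ≡ false` is mild.** -/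
theorem MildInst.of_hasCutRoots {F : Finset E} (h : HasCutRoots ends o a₁ a₂ a₃ b F) :
    MildInst ends o a₁ a₂ a₃ b F (fun _ => false) := by
  obtain ⟨c, VL, VH, hc⟩ := h
  exact MildInst.of_uncrossed ends o a₁ a₂ a₃ b (UncrossedInst.of_cutRoots ends o a₁ a₂ a₃ b hc)

omit [Fintype E] in
/-- **On the domain of record `¬ HasCutRoots` follows from `¬ MildInst`** (the conjunct is
redundant). -/
theorem not_hasCutRoots_of_not_mild {F : Finset E}
    (h : ¬ MildInst ends o a₁ a₂ a₃ b F (fun _ => false)) : ¬ HasCutRoots ends o a₁ a₂ a₃ b F :=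
  fun hr => h (MildInst.of_hasCutRoots ends o a₁ a₂ a₃ b hr)

end MildCutRoots

end RootBridge

end CovForm

end Summit.Ventures.PercRepro2
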